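import Mathlib
import Summits.NavierStokesRegularity.NavierStokesRegularity.Theorems.EulerZoomLiouvillePowerGaugeEulerLiouvilleLagrangianTraceStay
import HarnessLib

/-!
# Crux `EulerZoomLiouville.PowerGaugeEulerLiouville` (stmt-NavierStokesRegularity-19832): THE LAGRANGIAN TRACE LAW — plate t59-LT of nsreg-p2 ROUND-54 «THE TRACE» (part 2/2: the law)

Width/portrait piece for THE ONE STATEMENT `stub_selfSimilarC2Needle` (LEAD skeleton `Cruxes/PowerGaugeEulerLiouville/Lines/birth.lean` v111,
ns-typeII-p2 g16), `--supports stmt-NavierStokesRegularity-19832 --as helper`.  Text = nsreg-p2 g44's `NsregP2.R54.Trace.LagrangianTraceLaw ρ V`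
(`r54/Sketch54.lean` sha16 f78682d2f4ee3f27) VERBATIM, for `−½ < ρ ≤ 1` (keys 09:01:11Z / 09:04:21Z: «ESC + MS + monotone convergence in the horizon +
cut-off independence on tube trajectories»).

For a self-similar Euler profile `(V, P)` (`γ = 1/(2+ρ)`) with finite weighted strain budget `∫‖DV‖²‖y‖^{ρ−1} < ∞` and the A-gauge, along ANY global
forward similarity flow `Φ` (interface `IsForwardSimilarityFlow`: `Φ_0 = id`, `∂_sΦ_s y = γΦ_s y + V(Φ_s y)` for `s ≥ 0`), almost every label has
INTEGRABLE STRAIN `∫_0^∞ ‖DV(Φ_s y)‖ ds < ∞` (`lagrangianTraceLaw`).  Proof: fix `C ≥ 2`, `L ≥ 1` and cut-offs `V′_S` for every horizon `S ∈ ℕ`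
(`Trace.exists_C2_cutoff`).  By cut-off independence (`Trace.traj_eq_flow_of_flow_stay`, `…_of_mem_ball`) the labels whose cut-off orbit stays in
the `CL`-tube up to `S` form a DECREASING family `Stay S` on which `Φ = Ψ^{(S)}`; its complement in `B_L` lies in the escape set, of volume
`≤ 8A(CL)^{−(1+2ρ)}` for every `S` (ns-ezl-w3's ★ `Trace.forwardEscapeLaw`), hence so does `B_L ∖ ⋂_S Stay S` (monotone union); on `⋂_S Stay S`
THE MEAN STRAIN LAW (`Trace.meanStrainLaw`, bound `M` UNIFORM in `S`) and monotone convergence give `∫_{⋂ Stay} ∫_0^∞‖DV(Φ_s y)‖ ≤ M`, so the strain is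
integrable a.e. there; thus `vol{y ∈ B_L : strain not integrable} ≤ 8A(CL)^{−(1+2ρ)}` for every `C`, i.e. `0` (`ρ > −½`), for every `L`.
With ★ `RayVorticity.rayVorticityLaw` (ns-ezl-w3, p707221) this makes R54's `ae_vorticityLimit_of_traceLaw` unconditional.

HONEST FRAMING: a portrait instrument about HYPOTHETICAL profiles; nothing about the crux E (19832 OPEN) or NS regularity is proved.
[nsreg-p2 R54 §C t59-LT; cite: ConstantinIgnatovaVicol2026Putative, §3.4.1 eq. (3.21)–(3.22), §3.5]
-/

noncomputable section

set_option linter.dupNamespace false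

open MeasureTheory Set Filter Topology Metric Function
open scoped RealInnerProductSpace NNReal ENNReal ContDiff

namespace Summit.NavierStokesRegularity.NavierStokesRegularity.Theorems.PowerGaugeEulerLiouville.Trace

open Literature.Analysis Literature.Analysis.FluidPDE
open Summit.NavierStokesRegularity.NavierStokesRegularity.Theorems.PowerGaugeEulerLiouville.BernoulliLandscape
open Summit.NavierStokesRegularity.NavierStokesRegularity.Theorems.PowerGaugeEulerLiouville.NeedleFeeding

/-- **The localized Lagrangian trace bound.**  In the setting of `lagrangianTraceLaw`, for `C ≥ 2` and `L ≥ 1` the labels in `B_L` along which the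
strain of the global flow is NOT integrable have volume `≤ 8A(CL)^{−(1+2ρ)}`: cut-offs for every horizon (`exists_C2_cutoff`), the non-staying labels
are few (`volume_ball_diff_iInter_stay_le`), and on the staying labels the strain is a.e. integrable (`ae_integrableOn_strain_of_iInter_stay`).
[nsreg-p2 R54 §C t59-LT; cite: ConstantinIgnatovaVicol2026Putative, §3.4.1 eq. (3.21)–(3.22), §3.5] -/
theorem volume_notIntegrable_strain_inter_ball_le {ρ : ℝ} (hρ : -2 < ρ) (hρ1 : ρ ≤ 1)
    {V : EuclideanSpace ℝ (Fin 3) → EuclideanSpace ℝ (Fin 3)} {P : EuclideanSpace ℝ (Fin 3) → ℝ}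
    (hprof : IsSelfSimilarEulerProfile (1 / (2 + ρ)) 0 V P)
    (hE : (∫⁻ y, ‖fderiv ℝ V y‖ₑ ^ 2 * ENNReal.ofReal (‖y‖ ^ (ρ - 1))) ≠ ⊤) {A : ℝ}
    (hA : ∀ R : ℝ, 1 ≤ R → ∫ y in ball (0 : EuclideanSpace ℝ (Fin 3)) R, ‖V y‖ ^ 2 ≤ A * R ^ (1 - 2 * ρ))
    {Φ : ℝ → EuclideanSpace ℝ (Fin 3) → EuclideanSpace ℝ (Fin 3)} (hΦ0 : ∀ y, Φ 0 y = y)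
    (hΦ : ∀ y (s : ℝ), 0 ≤ s → HasDerivAt (fun σ => Φ σ y) ((1 / (2 + ρ)) • Φ s y + V (Φ s y)) s)
    {C L : ℝ} (hC : 2 ≤ C) (hL : 1 ≤ L) :
    volume ({y | ¬ IntegrableOn (fun s => ‖fderiv ℝ V (Φ s y)‖) (Ici 0)} ∩ ball (0 : EuclideanSpace ℝ (Fin 3)) L) ≤
      ENNReal.ofReal (8 * A * (C * L) ^ (-(1 + 2 * ρ))) := by
  have hVc2 : ContDiff ℝ 2 V := hprof.contDiff_velocity
  have hCL0 : 0 < C * L := by nlinarith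
  -- cut-offs for every horizon `S ∈ ℕ`
  have hcut : ∀ S : ℕ, ∃ (V' : EuclideanSpace ℝ (Fin 3) → EuclideanSpace ℝ (Fin 3)) (K : ℝ), ContDiff ℝ 2 V' ∧
      (∀ y, ‖fderiv ℝ V' y‖ ≤ K) ∧ ∀ w ∈ ball (0 : EuclideanSpace ℝ (Fin 3)) (2 * C * L * Real.exp ((S : ℝ) / (2 + ρ)) + 1), V' w = V w :=
    fun S => exists_C2_cutoff hVc2 (2 * C * L * Real.exp ((S : ℝ) / (2 + ρ)) + 1)
      (by have := Real.exp_pos ((S : ℝ) / (2 + ρ)); nlinarith)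
  choose Vc Kc hVc hKc hVcV using hcut
  obtain ⟨Ψ, hΨ⟩ : ∃ Ψ : ℕ → ℝ → EuclideanSpace ℝ (Fin 3) → EuclideanSpace ℝ (Fin 3),
      Ψ = fun (S : ℕ) (σ : ℝ) (y : EuclideanSpace ℝ (Fin 3)) =>
        ODE.evolutionMap (fun _ : ℝ => selfSimilarTransport (1 / (2 + ρ)) (0 : EuclideanSpace ℝ (Fin 3)) (Vc S)) 0 σ y := ⟨_, rfl⟩
  obtain ⟨Stay, hStay⟩ : ∃ Stay : ℕ → Set (EuclideanSpace ℝ (Fin 3)), Stay = fun S : ℕ => {y ∈ ball (0 : EuclideanSpace ℝ (Fin 3)) L |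
      ∀ σ ∈ Icc 0 (S : ℝ), ‖Ψ S σ y‖ ≤ C * L * Real.exp (σ / (2 + ρ))} := ⟨_, rfl⟩
  have hStaym : ∀ S, MeasurableSet (Stay S) := by
    intro S
    rw [hStay]
    show MeasurableSet {y ∈ ball (0 : EuclideanSpace ℝ (Fin 3)) L | ∀ σ ∈ Icc 0 (S : ℝ), ‖Ψ S σ y‖ ≤ C * L * Real.exp (σ / (2 + ρ))}
    rw [show {y ∈ ball (0 : EuclideanSpace ℝ (Fin 3)) L | ∀ σ ∈ Icc 0 (S : ℝ), ‖Ψ S σ y‖ ≤ C * L * Real.exp (σ / (2 + ρ))} =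
      ball (0 : EuclideanSpace ℝ (Fin 3)) L ∩ {y | ∀ σ ∈ Icc 0 (S : ℝ), ‖Ψ S σ y‖ ≤ C * L * Real.exp (σ / (2 + ρ))} by
        ext y; simp only [mem_setOf_eq, mem_inter_iff], hΨ]
    exact measurableSet_ball.inter
      (isClosed_forwardStay_fun (γ := 1 / (2 + ρ)) (hVc S) (hKc S) S (fun σ => C * L * Real.exp (σ / (2 + ρ)))).measurableSet
  have hP1 := volume_ball_diff_iInter_stay_le hρ hprof hA hΦ0 hΦ hC hL hVc hKc hVcV hΨ hStay
  have hP2 := ae_integrableOn_strain_of_iInter_stay hρ hρ1 hprof hE hΦ0 hΦ hC hL hVc hKc hVcV hΨ hStay hStaym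
  obtain ⟨Bd, hBd⟩ : ∃ Bd : Set (EuclideanSpace ℝ (Fin 3)),
      Bd = {y | ¬ (y ∈ (⋂ S, Stay S) → IntegrableOn (fun s => ‖fderiv ℝ V (Φ s y)‖) (Ici 0))} := ⟨_, rfl⟩
  have hnull : volume Bd = 0 := by
    have h := hP2
    rw [ae_iff] at h
    rw [hBd]
    exact h
  obtain ⟨Es, hEs⟩ : ∃ Es : Set (EuclideanSpace ℝ (Fin 3)), Es = ball (0 : EuclideanSpace ℝ (Fin 3)) L \ ⋂ S, Stay S := ⟨_, rfl⟩
  have hEsle : volume Es ≤ ENNReal.ofReal (8 * A * (C * L) ^ (-(1 + 2 * ρ))) := by rw [hEs]; exact hP1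
  have hsub : {y | ¬ IntegrableOn (fun s => ‖fderiv ℝ V (Φ s y)‖) (Ici 0)} ∩ ball (0 : EuclideanSpace ℝ (Fin 3)) L ⊆ Es ∪ Bd := by
    rintro y ⟨hbad, hyL⟩
    by_cases hy : y ∈ ⋂ S, Stay S
    · refine Or.inr ?_
      rw [hBd]
      exact fun h => hbad (h hy)
    · refine Or.inl ?_
      rw [hEs]
      exact ⟨hyL, hy⟩
  have hu : volume (Es ∪ Bd) ≤ volume Es + volume Bd := measure_union_le Es Bd
  have hfin : volume (Es ∪ Bd) ≤ ENNReal.ofReal (8 * A * (C * L) ^ (-(1 + 2 * ρ))) := by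
    refine hu.trans ?_
    rw [hnull, add_zero]
    exact hEsle
  exact (measure_mono hsub).trans hfin

/-- ★ **THE LAGRANGIAN TRACE LAW (t59-LT, `NsregP2.R54.Trace.LagrangianTraceLaw ρ V` with the interface `IsForwardSimilarityFlow` destructured into
its two fields, `−½ < ρ ≤ 1`).**  For a self-similar Euler profile with finite weighted strain budget and the A-gauge, along any global forward
similarity flow `Φ` (`Φ_0 = id`, `∂_sΦ_s y = Φ_s y/(2+ρ) + V(Φ_s y)` for `s ≥ 0`), almost every label has integrable strain `∫_0^∞‖DV(Φ_s y)‖ds < ∞`.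
By `volume_notIntegrable_strain_inter_ball_le` the bad labels in `B_L` have volume `≤ 8A(CL)^{−(1+2ρ)}` for every `C ≥ 2`, which tends to `0`
as `C → ∞` (`1 + 2ρ > 0`); cover by balls.  With `RayVorticity.rayVorticityLaw` (ns-ezl-w3) this makes R54's `ae_vorticityLimit_of_traceLaw`
unconditional. [nsreg-p2 R54 §C t59-LT; cite: ConstantinIgnatovaVicol2026Putative, §3.4.1 eq. (3.21)–(3.22), §3.5] -/
theorem lagrangianTraceLaw {ρ : ℝ} (hρ : -1 / 2 < ρ) (hρ1 : ρ ≤ 1) (V : EuclideanSpace ℝ (Fin 3) → EuclideanSpace ℝ (Fin 3)) :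
    ∀ P : EuclideanSpace ℝ (Fin 3) → ℝ, IsSelfSimilarEulerProfile (1 / (2 + ρ)) 0 V P →
    (∫⁻ y, ‖fderiv ℝ V y‖ₑ ^ 2 * ENNReal.ofReal (‖y‖ ^ (ρ - 1))) ≠ ⊤ →
    (∃ A : ℝ, ∀ R : ℝ, 1 ≤ R → ∫ y in ball (0 : EuclideanSpace ℝ (Fin 3)) R, ‖V y‖ ^ 2 ≤ A * R ^ (1 - 2 * ρ)) →
    ∀ Φ : ℝ → EuclideanSpace ℝ (Fin 3) → EuclideanSpace ℝ (Fin 3), (∀ y, Φ 0 y = y) →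
      (∀ y (s : ℝ), 0 ≤ s → HasDerivAt (fun σ => Φ σ y) ((1 / (2 + ρ)) • Φ s y + V (Φ s y)) s) →
      ∀ᵐ y : EuclideanSpace ℝ (Fin 3), IntegrableOn (fun s => ‖fderiv ℝ V (Φ s y)‖) (Ici 0) := by
  intro P hprof hE hA Φ hΦ0 hΦ
  obtain ⟨A, hA⟩ := hA
  have hρ2 : -2 < ρ := by linarith
  rw [ae_iff]
  have hcov : {y | ¬ IntegrableOn (fun s => ‖fderiv ℝ V (Φ s y)‖) (Ici 0)} =
      ⋃ n : ℕ, ({y | ¬ IntegrableOn (fun s => ‖fderiv ℝ V (Φ s y)‖) (Ici 0)} ∩ ball (0 : EuclideanSpace ℝ (Fin 3)) ((n : ℝ) + 1)) := by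
    ext y
    simp only [mem_iUnion, mem_inter_iff, mem_setOf_eq, mem_ball_zero_iff]
    constructor
    · intro h
      obtain ⟨n, hn⟩ := exists_nat_gt ‖y‖
      exact ⟨n, h, by linarith⟩
    · rintro ⟨n, h, -⟩; exact h
  rw [hcov]
  refine measure_iUnion_null fun n => ?_
  have hL : (1 : ℝ) ≤ n + 1 := by
    have := (n.cast_nonneg : (0 : ℝ) ≤ n)
    linarith
  have hbound : ∀ C : ℕ, (2 : ℝ) ≤ C →
      volume ({y | ¬ IntegrableOn (fun s => ‖fderiv ℝ V (Φ s y)‖) (Ici 0)} ∩ ball (0 : EuclideanSpace ℝ (Fin 3)) ((n : ℝ) + 1)) ≤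
        ENNReal.ofReal (8 * A * ((C : ℝ) * ((n : ℝ) + 1)) ^ (-(1 + 2 * ρ))) :=
    fun C hC => volume_notIntegrable_strain_inter_ball_le hρ2 hρ1 hprof hE hA hΦ0 hΦ hC hL
  have htend : Tendsto (fun C : ℕ => ENNReal.ofReal (8 * A * ((C : ℝ) * ((n : ℝ) + 1)) ^ (-(1 + 2 * ρ)))) atTop (𝓝 0) := by
    rw [← ENNReal.ofReal_zero]
    refine ENNReal.tendsto_ofReal ?_
    have h1 : Tendsto (fun C : ℕ => (C : ℝ) * ((n : ℝ) + 1)) atTop atTop :=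
      tendsto_natCast_atTop_atTop.atTop_mul_const (by linarith)
    have h2 : Tendsto (fun x : ℝ => x ^ (-(1 + 2 * ρ))) atTop (𝓝 0) := tendsto_rpow_neg_atTop (by linarith)
    have h3 := (h2.comp h1).const_mul (8 * A)
    rw [mul_zero] at h3
    exact h3
  refine le_antisymm ?_ bot_le
  exact ge_of_tendsto htend (Filter.eventually_atTop.2 ⟨2, fun C hC => hbound C (by exact_mod_cast hC)⟩)

end Summit.NavierStokesRegularity.NavierStokesRegularity.Theorems.PowerGaugeEulerLiouville.Trace
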